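import Summits.AtomisticToContinuum.FouriersLaw.Theorems.OddSectorIrreversibilityResponseDensityDualityDerivative

/-!
# The derivative of the interpolation functional is a pure cutoff error, and its bound

Helper file for item stmt-AtomisticToContinuum-9144 (`ResponseDensity`, route
`OddSectorIrreversibility`, sub-problem `FouriersLaw` of `AtomisticToContinuum`), part of the
detailed-balance (hDUAL) line. Notation as in `…DualityDerivative.lean`; `Γ = carreDuChamp v_L v_R`:

* `pinnedChain_dualityDerivative_eq` — **`Ψ_R'(s) = ∫ π u_s (w_{t-s}(Θx) (Lχ_R)(Θx) + Γ(χ_R, w_{t-s})(Θx)) dx`**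
  (commutation `L P_s = P_s L` on `C_c^∞`, the generator-level detailed balance
  `∫ π g₁ Lg₂ = ∫ π (L(g₁∘Θ))∘Θ g₂`, and the product rule `L(χw) = χLw + wLχ + Γ(χ,w)`);
* `pinnedChain_abs_dualityDerivative_le` — **`|Ψ_R'(s)| ≤ C_F C_G (∫ π|Lχ_R|) + C_F ((1/2η) (∫ πΓ(χ_R)) + (η/2) ∫ π χ_{4R}² Γ(w_{t-s}))`**.

No definitions.
-/

noncomputable section

open MeasureTheory ProbabilityTheory Filter Topology Set Function Metric
open scoped NNReal ENNReal ContDiff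

namespace Summit.AtomisticToContinuum.FouriersLaw.Theorems

open Literature.MathematicalPhysics.KineticTheory.HeatConduction
open Literature.Probability.Process Literature.MathematicalPhysics.KineticTheory OscillatorChain

variable {N : ℕ}

section Duality

variable {ω₂ lam β γ : ℝ} (hω : 0 < ω₂) (hl : 0 ≤ lam) (hβ : 0 ≤ β) (hγ : 0 < γ) (hN : 0 < N)
  {T : ℝ} (hT : 0 < T) {F G : PhaseSpace N → ℝ} (hF : ContDiff ℝ ∞ F) (hFc : HasCompactSupport F)
  (hG : ContDiff ℝ ∞ G) (hGc : HasCompactSupport G)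
include hω hl hβ hγ hN hT hF hFc hG hGc

/-- **The derivative of the interpolation functional is a cutoff error.** For `0 < s < t`, `R > 0`:
`∫ π χ_R (-(P_{t-s}L(G∘Θ))(Θx) u_s + w_{t-s}(Θx) P_s(LF)) dx
   = ∫ π u_s (w_{t-s}(Θx) (Lχ_R)(Θx) + Γ(χ_R, w_{t-s})(Θx)) dx`. -/
theorem pinnedChain_dualityDerivative_eq {t : ℝ} {R : ℝ} (hR : 0 < R) {s : ℝ} (hs : 0 < s) (hst : s < t) :
    ∫ x, (pinnedChain ω₂ lam β γ).gibbsDensity N T x *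
        smoothCutoff ((pinnedChain ω₂ lam β γ).hamiltonian N x / R) *
        (-(∫ y, (pinnedChain ω₂ lam β γ).generator N T T (fun z => G (z.1, -z.2)) y
              ∂((pinnedChain ω₂ lam β γ).transitionKernel N T T (t - s).toNNReal (x.1, -x.2))) *
            (∫ y, F y ∂((pinnedChain ω₂ lam β γ).transitionKernel N T T s.toNNReal x)) +
          (∫ y, G (y.1, -y.2) ∂((pinnedChain ω₂ lam β γ).transitionKernel N T T (t - s).toNNReal (x.1, -x.2))) *
            ∫ y, (pinnedChain ω₂ lam β γ).generator N T T F y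
              ∂((pinnedChain ω₂ lam β γ).transitionKernel N T T s.toNNReal x)) =
      ∫ x, (pinnedChain ω₂ lam β γ).gibbsDensity N T x *
        (∫ y, F y ∂((pinnedChain ω₂ lam β γ).transitionKernel N T T s.toNNReal x)) *
        ((∫ y, G (y.1, -y.2) ∂((pinnedChain ω₂ lam β γ).transitionKernel N T T (t - s).toNNReal (x.1, -x.2))) *
            (pinnedChain ω₂ lam β γ).generator N T T
              (fun z => smoothCutoff ((pinnedChain ω₂ lam β γ).hamiltonian N z / R)) (x.1, -x.2) +
          carreDuChamp ((pinnedChain ω₂ lam β γ).bathVecL N T) ((pinnedChain ω₂ lam β γ).bathVecR N T)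
            (fun z => smoothCutoff ((pinnedChain ω₂ lam β γ).hamiltonian N z / R))
            (fun z => ∫ y, G (y.1, -y.2) ∂((pinnedChain ω₂ lam β γ).transitionKernel N T T (t - s).toNNReal z))
            (x.1, -x.2)) := by
  haveI := isAddHaarMeasure_volume_phaseSpace N
  have hU : ContDiff ℝ ∞ (pinnedChain ω₂ lam β γ).U := pinnedChain_contDiff_U ω₂ lam β γ
  have hV : ContDiff ℝ ∞ (pinnedChain ω₂ lam β γ).V := pinnedChain_contDiff_V ω₂ lam β γ
  have hγT : 0 ≤ (pinnedChain ω₂ lam β γ).γ * T := mul_nonneg hγ.le hT.le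
  have hF2 : ContDiff ℝ 2 F := hF.of_le (by norm_cast)
  have hGt : ContDiff ℝ ∞ fun z : PhaseSpace N => G (z.1, -z.2) := contDiff_comp_momentumFlip hG
  have hGtc : HasCompactSupport fun z : PhaseSpace N => G (z.1, -z.2) := hasCompactSupport_comp_momentumFlip hGc
  have hGt2 : ContDiff ℝ 2 fun z : PhaseSpace N => G (z.1, -z.2) := hGt.of_le (by norm_cast)
  obtain ⟨CF, hCF⟩ : ∃ C, ∀ y, ‖F y‖ ≤ C := hF.continuous.bounded_above_of_compact_support hFc
  obtain ⟨CG, hCG⟩ : ∃ C, ∀ y : PhaseSpace N, ‖G (y.1, -y.2)‖ ≤ C := hGt.continuous.bounded_above_of_compact_support hGtc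
  have hLFc : Continuous ((pinnedChain ω₂ lam β γ).generator N T T F) :=
    (pinnedChain ω₂ lam β γ).continuous_generator (pinnedChain_contDiff_U ω₂ lam β γ)
      (pinnedChain_contDiff_V ω₂ lam β γ) N T T hF2
  have hLGc : Continuous ((pinnedChain ω₂ lam β γ).generator N T T fun z => G (z.1, -z.2)) :=
    (pinnedChain ω₂ lam β γ).continuous_generator (pinnedChain_contDiff_U ω₂ lam β γ)
      (pinnedChain_contDiff_V ω₂ lam β γ) N T T hGt2
  obtain ⟨CLF, hCLF⟩ := (pinnedChain ω₂ lam β γ).exists_bound_generator (pinnedChain_contDiff_U ω₂ lam β γ)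
    (pinnedChain_contDiff_V ω₂ lam β γ) N T T hF2 hFc
  obtain ⟨CLG, hCLG⟩ := (pinnedChain ω₂ lam β γ).exists_bound_generator (pinnedChain_contDiff_U ω₂ lam β γ)
    (pinnedChain_contDiff_V ω₂ lam β γ) N T T hGt2 hGtc
  -- names (fixed times)
  obtain ⟨u, hu⟩ : ∃ u : PhaseSpace N → ℝ, u = fun z =>
      ∫ y, F y ∂((pinnedChain ω₂ lam β γ).transitionKernel N T T s.toNNReal z) := ⟨_, rfl⟩
  obtain ⟨gF, hgF⟩ : ∃ g : PhaseSpace N → ℝ, g = fun z => ∫ y, (pinnedChain ω₂ lam β γ).generator N T T F y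
      ∂((pinnedChain ω₂ lam β γ).transitionKernel N T T s.toNNReal z) := ⟨_, rfl⟩
  obtain ⟨w, hw⟩ : ∃ w : PhaseSpace N → ℝ, w = fun z =>
      ∫ y, G (y.1, -y.2) ∂((pinnedChain ω₂ lam β γ).transitionKernel N T T (t - s).toNNReal z) := ⟨_, rfl⟩
  obtain ⟨gG, hgG⟩ : ∃ g : PhaseSpace N → ℝ, g = fun z =>
      ∫ y, (pinnedChain ω₂ lam β γ).generator N T T (fun z => G (z.1, -z.2)) y
        ∂((pinnedChain ω₂ lam β γ).transitionKernel N T T (t - s).toNNReal z) := ⟨_, rfl⟩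
  obtain ⟨π, hπ⟩ : ∃ π : PhaseSpace N → ℝ, π = (pinnedChain ω₂ lam β γ).gibbsDensity N T := ⟨_, rfl⟩
  obtain ⟨χ, hχ⟩ : ∃ χ : PhaseSpace N → ℝ, χ = fun x => smoothCutoff ((pinnedChain ω₂ lam β γ).hamiltonian N x / R) :=
    ⟨_, rfl⟩
  set L := (pinnedChain ω₂ lam β γ).generator N T T with hL
  set Γ := carreDuChamp ((pinnedChain ω₂ lam β γ).bathVecL N T) ((pinnedChain ω₂ lam β γ).bathVecR N T) with hΓ
  -- restate the goal with the names
  suffices hgoal : ∫ x, π x * χ x * (-gG (x.1, -x.2) * u x + w (x.1, -x.2) * gF x) =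
      ∫ x, π x * u x * (w (x.1, -x.2) * L χ (x.1, -x.2) + Γ χ w (x.1, -x.2)) by
    rw [hu, hw, hgF, hgG, hπ, hχ] at hgoal
    exact hgoal
  -- regularity
  have hts : 0 < t - s := by linarith
  have hsmu : ContDiff ℝ ∞ u := by
    have h := pinnedChain_contDiffOn_forecast hω hl hβ hγ hN hT hT.le hF.continuous hFc
    have h2 := h.comp_contDiff (contDiff_const.prodMk contDiff_id) fun z => ⟨hs, Set.mem_univ _⟩
    rw [hu]; exact h2
  have hsmw : ContDiff ℝ ∞ w := by
    have h := pinnedChain_contDiffOn_forecast hω hl hβ hγ hN hT hT.le hGt.continuous hGtc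
    have h2 := h.comp_contDiff (contDiff_const.prodMk contDiff_id) fun z => ⟨hts, Set.mem_univ _⟩
    rw [hw]; exact h2
  have hu2 : ContDiff ℝ 2 u := hsmu.of_le (by norm_cast)
  have hw2 : ContDiff ℝ 2 w := hsmw.of_le (by norm_cast)
  have hχsm : ContDiff ℝ ∞ χ := by rw [hχ]; exact pinnedChain_contDiff_cutoff N γ R
  have hχ2 : ContDiff ℝ 2 χ := hχsm.of_le (by norm_cast)
  have hχs : HasCompactSupport χ := by rw [hχ]; exact pinnedChain_hasCompactSupport_cutoff hω hl hβ N γ hR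
  have hcommF : ∀ x, L u x = gF x := by
    intro x; rw [hu, hgF]
    exact pinnedChain_generator_forecast_eq hω hl hβ hγ hN hT hT.le hF hFc hs x
  have hcommG : ∀ x, L w x = gG x := by
    intro x; rw [hw, hgG]
    exact pinnedChain_generator_forecast_eq hω hl hβ hγ hN hT hT.le hGt hGtc hts x
  have huc : Continuous u := hsmu.continuous
  have hwc : Continuous w := hsmw.continuous
  have hgFc : Continuous gF := by
    rw [hgF]; exact pinnedChain_continuous_integral_transitionKernel hω hl hβ hγ.le N T T _ hLFc hCLF
  have hgGc : Continuous gG := by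
    rw [hgG]; exact pinnedChain_continuous_integral_transitionKernel hω hl hβ hγ.le N T T _ hLGc hCLG
  have hπc : Continuous π := by
    rw [hπ]; exact Real.continuous_exp.comp (((pinnedChain_contDiff_hamiltonian ω₂ lam β γ N (n := 0)).continuous).neg.div_const T)
  have hflip : Continuous fun x : PhaseSpace N => ((x.1, -x.2) : PhaseSpace N) := continuous_fst.prodMk continuous_snd.neg
  have hχc : Continuous χ := hχsm.continuous
  have hLχc : Continuous (L χ) :=
    (pinnedChain ω₂ lam β γ).continuous_generator (pinnedChain_contDiff_U ω₂ lam β γ) (pinnedChain_contDiff_V ω₂ lam β γ) N T T hχ2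
  have hLχs : HasCompactSupport (L χ) := (pinnedChain ω₂ lam β γ).hasCompactSupport_generator N T T hχ2 hχs
  have hΓc : Continuous (Γ χ w) := by
    have hD : Continuous (fderiv ℝ χ) := hχsm.continuous_fderiv (by simp)
    have hD' : Continuous (fderiv ℝ w) := hsmw.continuous_fderiv (by simp)
    rw [hΓ, show carreDuChamp ((pinnedChain ω₂ lam β γ).bathVecL N T) ((pinnedChain ω₂ lam β γ).bathVecR N T) χ w =
      fun x => _ from funext fun x => carreDuChamp_def _ _ χ w x]
    fun_prop
  have hΓs : HasCompactSupport (Γ χ w) := by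
    rw [hΓ, show carreDuChamp ((pinnedChain ω₂ lam β γ).bathVecL N T) ((pinnedChain ω₂ lam β γ).bathVecR N T) χ w =
      fun x => _ from funext fun x => carreDuChamp_def _ _ χ w x]
    exact ((hχs.fderiv_apply (𝕜 := ℝ) _).mul_right).add ((hχs.fderiv_apply (𝕜 := ℝ) _).mul_right)
  -- the generator-level detailed balance with `g₁ = χ · (w ∘ Θ)`, `g₂ = u`
  have hg₁ : ContDiff ℝ ∞ fun x => χ x * w (x.1, -x.2) := hχsm.mul (contDiff_comp_momentumFlip hsmw)
  have hg₁c : HasCompactSupport fun x => χ x * w (x.1, -x.2) := hχs.mul_right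
  have hT2 := langevin_integral_gibbs_mul_generator (pinnedChain ω₂ lam β γ) hU hV hN hγ.le hT hg₁ hg₁c hsmu
  have hχΘ : ∀ x : PhaseSpace N, χ (x.1, -x.2) = χ x := fun x => by
    rw [hχ]; simp only [OscillatorChain.hamiltonian_neg_momentum]
  have hflipflip : (fun y : PhaseSpace N => χ (y.1, -y.2) * w ((y.1, -y.2).1, -(y.1, -y.2).2)) = fun y => χ y * w y := by
    funext y; rw [hχΘ]; simp
  have hprod : ∀ z, L (fun y => χ y * w y) z = χ z * L w z + w z * L χ z + Γ χ w z := by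
    intro z
    rw [hL, ← (pinnedChain ω₂ lam β γ).sdeGenerator_drift_eq_generator hN hγT hγT (hχ2.mul hw2),
      ← (pinnedChain ω₂ lam β γ).sdeGenerator_drift_eq_generator hN hγT hγT hχ2,
      ← (pinnedChain ω₂ lam β γ).sdeGenerator_drift_eq_generator hN hγT hγT hw2, sdeGenerator_mul' _ _ _ hχ2 hw2 z]
  simp only [hflipflip] at hT2
  -- `hT2 : ∫ π (χ w∘Θ) (L u) = ∫ π (L(χ w))(Θx) u`, in the names
  have hT2' : ∫ x, π x * (χ x * w (x.1, -x.2)) * L u x = ∫ x, π x * L (fun y => χ y * w y) (x.1, -x.2) * u x := by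
    rw [hπ, hL]; exact hT2
  -- integrability
  have hI1 : Integrable fun x => π x * (χ x * w (x.1, -x.2)) * gF x :=
    ((hπc.mul (hχc.mul (hwc.comp hflip))).mul hgFc).integrable_of_hasCompactSupport (hχs.mul_right.mul_left.mul_right)
  have hI2 : Integrable fun x => π x * χ x * (gG (x.1, -x.2) * u x) :=
    ((hπc.mul hχc).mul ((hgGc.comp hflip).mul huc)).integrable_of_hasCompactSupport (hχs.mul_left.mul_right)
  have hI3 : Integrable fun x => π x * (w (x.1, -x.2) * L χ (x.1, -x.2) + Γ χ w (x.1, -x.2)) * u x := by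
    refine ((hπc.mul (((hwc.comp hflip).mul (hLχc.comp hflip)).add (hΓc.comp hflip))).mul huc).integrable_of_hasCompactSupport ?_
    exact (((hasCompactSupport_comp_momentumFlip hLχs).mul_left).add (hasCompactSupport_comp_momentumFlip hΓs)).mul_left.mul_right
  -- rewrite the left-hand side as a difference and use `hT2`
  have eL : (fun x => π x * χ x * (-gG (x.1, -x.2) * u x + w (x.1, -x.2) * gF x)) =
      fun x => π x * (χ x * w (x.1, -x.2)) * gF x - π x * χ x * (gG (x.1, -x.2) * u x) := by
    funext x; ring
  have eT : (fun x => π x * (χ x * w (x.1, -x.2)) * gF x) = fun x => π x * (χ x * w (x.1, -x.2)) * L u x := by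
    funext x; rw [hcommF]
  rw [eL, integral_sub hI1 hI2, eT, hT2']
  have e3 : (fun x => π x * L (fun y => χ y * w y) (x.1, -x.2) * u x) =
      fun x => π x * (w (x.1, -x.2) * L χ (x.1, -x.2) + Γ χ w (x.1, -x.2)) * u x + π x * χ x * (gG (x.1, -x.2) * u x) := by
    funext x
    rw [hprod, hχΘ, hcommG]
    ring
  rw [e3, integral_add hI3 hI2, add_sub_cancel_right]
  exact integral_congr_ae (Eventually.of_forall fun x => by ring)

omit hFc in
/-- **The bound on the cutoff error.** For `s < t`, `R > 0`, `η > 0`, `|F| ≤ C_F`, `|G| ≤ C_G`: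
`|∫ π u_s (w_{t-s}(Θx)(Lχ_R)(Θx) + Γ(χ_R, w_{t-s})(Θx)) dx|
   ≤ C_F C_G ∫ π |Lχ_R| dx + C_F ((1/2η) ∫ π Γ(χ_R) dx + (η/2) ∫ π χ_{4R}² Γ(w_{t-s}) dx)`. -/
theorem pinnedChain_abs_dualityDerivative_le {t : ℝ} {R : ℝ} (hR : 0 < R) {η : ℝ} (hη : 0 < η) {s : ℝ}
    (hst : s < t) {CF CG : ℝ} (hCF : ∀ y, |F y| ≤ CF) (hCG : ∀ y, |G y| ≤ CG) :
    |∫ x, (pinnedChain ω₂ lam β γ).gibbsDensity N T x *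
        (∫ y, F y ∂((pinnedChain ω₂ lam β γ).transitionKernel N T T s.toNNReal x)) *
        ((∫ y, G (y.1, -y.2) ∂((pinnedChain ω₂ lam β γ).transitionKernel N T T (t - s).toNNReal (x.1, -x.2))) *
            (pinnedChain ω₂ lam β γ).generator N T T
              (fun z => smoothCutoff ((pinnedChain ω₂ lam β γ).hamiltonian N z / R)) (x.1, -x.2) +
          carreDuChamp ((pinnedChain ω₂ lam β γ).bathVecL N T) ((pinnedChain ω₂ lam β γ).bathVecR N T)
            (fun z => smoothCutoff ((pinnedChain ω₂ lam β γ).hamiltonian N z / R))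
            (fun z => ∫ y, G (y.1, -y.2) ∂((pinnedChain ω₂ lam β γ).transitionKernel N T T (t - s).toNNReal z))
            (x.1, -x.2))| ≤
      CF * CG * (∫ x, (pinnedChain ω₂ lam β γ).gibbsDensity N T x *
          |(pinnedChain ω₂ lam β γ).generator N T T
            (fun z => smoothCutoff ((pinnedChain ω₂ lam β γ).hamiltonian N z / R)) x|) +
        CF * (1 / (2 * η) * (∫ x, (pinnedChain ω₂ lam β γ).gibbsDensity N T x *
            carreDuChamp ((pinnedChain ω₂ lam β γ).bathVecL N T) ((pinnedChain ω₂ lam β γ).bathVecR N T)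
              (fun z => smoothCutoff ((pinnedChain ω₂ lam β γ).hamiltonian N z / R))
              (fun z => smoothCutoff ((pinnedChain ω₂ lam β γ).hamiltonian N z / R)) x) +
          η / 2 * ∫ x, (pinnedChain ω₂ lam β γ).gibbsDensity N T x *
            (smoothCutoff ((pinnedChain ω₂ lam β γ).hamiltonian N x / (4 * R)) ^ 2 *
              carreDuChamp ((pinnedChain ω₂ lam β γ).bathVecL N T) ((pinnedChain ω₂ lam β γ).bathVecR N T)
                (fun z => ∫ y, G (y.1, -y.2) ∂((pinnedChain ω₂ lam β γ).transitionKernel N T T (t - s).toNNReal z))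
                (fun z => ∫ y, G (y.1, -y.2) ∂((pinnedChain ω₂ lam β γ).transitionKernel N T T (t - s).toNNReal z)) x)) := by
  have hGt : ContDiff ℝ ∞ fun z : PhaseSpace N => G (z.1, -z.2) := contDiff_comp_momentumFlip hG
  have hGtc : HasCompactSupport fun z : PhaseSpace N => G (z.1, -z.2) := hasCompactSupport_comp_momentumFlip hGc
  have hCF0 : 0 ≤ CF := (abs_nonneg _).trans (hCF 0)
  have hCG0 : 0 ≤ CG := (abs_nonneg _).trans (hCG 0)
  -- names
  obtain ⟨u, hu⟩ : ∃ u : PhaseSpace N → ℝ, u = fun z =>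
      ∫ y, F y ∂((pinnedChain ω₂ lam β γ).transitionKernel N T T s.toNNReal z) := ⟨_, rfl⟩
  obtain ⟨w, hw⟩ : ∃ w : PhaseSpace N → ℝ, w = fun z =>
      ∫ y, G (y.1, -y.2) ∂((pinnedChain ω₂ lam β γ).transitionKernel N T T (t - s).toNNReal z) := ⟨_, rfl⟩
  obtain ⟨π, hπ⟩ : ∃ π : PhaseSpace N → ℝ, π = (pinnedChain ω₂ lam β γ).gibbsDensity N T := ⟨_, rfl⟩
  obtain ⟨χ, hχ⟩ : ∃ χ : PhaseSpace N → ℝ, χ = fun x => smoothCutoff ((pinnedChain ω₂ lam β γ).hamiltonian N x / R) :=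
    ⟨_, rfl⟩
  obtain ⟨χ₄, hχ₄⟩ : ∃ χ₄ : PhaseSpace N → ℝ, χ₄ = fun x => smoothCutoff ((pinnedChain ω₂ lam β γ).hamiltonian N x / (4 * R)) :=
    ⟨_, rfl⟩
  set L := (pinnedChain ω₂ lam β γ).generator N T T with hL
  set Γ := carreDuChamp ((pinnedChain ω₂ lam β γ).bathVecL N T) ((pinnedChain ω₂ lam β γ).bathVecR N T) with hΓ
  -- restate the goal with the names
  suffices hgoal : |∫ x, π x * u x * (w (x.1, -x.2) * L χ (x.1, -x.2) + Γ χ w (x.1, -x.2))| ≤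
      CF * CG * (∫ x, π x * |L χ x|) +
        CF * (1 / (2 * η) * (∫ x, π x * Γ χ χ x) + η / 2 * ∫ x, π x * (χ₄ x ^ 2 * Γ w w x)) by
    rw [hu, hw, hπ, hχ, hχ₄] at hgoal
    exact hgoal
  have hts : 0 < t - s := by linarith
  -- regularity
  have hsmw : ContDiff ℝ ∞ w := by
    have h := pinnedChain_contDiffOn_forecast hω hl hβ hγ hN hT hT.le hGt.continuous hGtc
    have h2 := h.comp_contDiff (contDiff_const.prodMk contDiff_id) fun z => ⟨hts, Set.mem_univ _⟩
    rw [hw]; exact h2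
  have hχsm : ContDiff ℝ ∞ χ := by rw [hχ]; exact pinnedChain_contDiff_cutoff N γ R
  have hχ2 : ContDiff ℝ 2 χ := hχsm.of_le (by norm_cast)
  have hχs : HasCompactSupport χ := by rw [hχ]; exact pinnedChain_hasCompactSupport_cutoff hω hl hβ N γ hR
  have hχ₄c : Continuous χ₄ := by rw [hχ₄]; exact (pinnedChain_contDiff_cutoff N γ (4 * R) (ω₂ := ω₂) (lam := lam) (β := β)).continuous
  have hχ₄s : HasCompactSupport χ₄ := by rw [hχ₄]; exact pinnedChain_hasCompactSupport_cutoff hω hl hβ N γ (by positivity)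
  have huc : Continuous u := by
    rw [hu]; exact pinnedChain_continuous_integral_transitionKernel hω hl hβ hγ.le N T T _ hF.continuous
      (fun y => by rw [Real.norm_eq_abs]; exact hCF y)
  have hwc : Continuous w := hsmw.continuous
  have hub : ∀ z, |u z| ≤ CF := fun z => by
    rw [hu]; exact pinnedChain_abs_forecast_le hω hl hβ hγ.le N T T hCF _ z
  have hwb : ∀ z, |w z| ≤ CG := fun z => by
    rw [hw]; exact pinnedChain_abs_forecast_le hω hl hβ hγ.le N T T (fun y => hCG _) _ z
  have hπc : Continuous π := by
    rw [hπ]; exact Real.continuous_exp.comp (((pinnedChain_contDiff_hamiltonian ω₂ lam β γ N (n := 0)).continuous).neg.div_const T)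
  have hπ0 : ∀ x, 0 < π x := fun x => by rw [hπ]; exact (pinnedChain ω₂ lam β γ).gibbsDensity_pos N T x
  have hπΘ : ∀ x : PhaseSpace N, π (x.1, -x.2) = π x := fun x => by
    rw [hπ]; simp only [OscillatorChain.gibbsDensity, OscillatorChain.hamiltonian_neg_momentum]
  have hflip : Continuous fun x : PhaseSpace N => ((x.1, -x.2) : PhaseSpace N) := continuous_fst.prodMk continuous_snd.neg
  have hLχc : Continuous (L χ) :=
    (pinnedChain ω₂ lam β γ).continuous_generator (pinnedChain_contDiff_U ω₂ lam β γ) (pinnedChain_contDiff_V ω₂ lam β γ) N T T hχ2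
  have hLχs : HasCompactSupport (L χ) := (pinnedChain ω₂ lam β γ).hasCompactSupport_generator N T T hχ2 hχs
  have hΓχwc : Continuous (Γ χ w) := by
    have hD : Continuous (fderiv ℝ χ) := hχsm.continuous_fderiv (by simp)
    have hD' : Continuous (fderiv ℝ w) := hsmw.continuous_fderiv (by simp)
    rw [hΓ, show carreDuChamp ((pinnedChain ω₂ lam β γ).bathVecL N T) ((pinnedChain ω₂ lam β γ).bathVecR N T) χ w =
      fun x => _ from funext fun x => carreDuChamp_def _ _ χ w x]
    fun_prop
  have hΓχχc : Continuous (Γ χ χ) := by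
    have hD : Continuous (fderiv ℝ χ) := hχsm.continuous_fderiv (by simp)
    rw [hΓ, show carreDuChamp ((pinnedChain ω₂ lam β γ).bathVecL N T) ((pinnedChain ω₂ lam β γ).bathVecR N T) χ χ =
      fun x => _ from funext fun x => carreDuChamp_def _ _ χ χ x]
    fun_prop
  have hΓwwc : Continuous (Γ w w) := by
    have hD' : Continuous (fderiv ℝ w) := hsmw.continuous_fderiv (by simp)
    rw [hΓ, show carreDuChamp ((pinnedChain ω₂ lam β γ).bathVecL N T) ((pinnedChain ω₂ lam β γ).bathVecR N T) w w =
      fun x => _ from funext fun x => carreDuChamp_def _ _ w w x]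
    fun_prop
  have hΓχχs : HasCompactSupport (Γ χ χ) := by
    rw [hΓ, show carreDuChamp ((pinnedChain ω₂ lam β γ).bathVecL N T) ((pinnedChain ω₂ lam β γ).bathVecR N T) χ χ =
      fun x => _ from funext fun x => carreDuChamp_def _ _ χ χ x]
    exact ((hχs.fderiv_apply (𝕜 := ℝ) _).mul_right).add ((hχs.fderiv_apply (𝕜 := ℝ) _).mul_right)
  -- the pointwise bound
  have hpt : ∀ x, ‖π x * u x * (w (x.1, -x.2) * L χ (x.1, -x.2) + Γ χ w (x.1, -x.2))‖ ≤
      CF * CG * (π x * |L χ (x.1, -x.2)|) + CF * (1 / (2 * η) * (π x * Γ χ χ (x.1, -x.2)) +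
        η / 2 * (π x * (χ₄ (x.1, -x.2) ^ 2 * Γ w w (x.1, -x.2)))) := by
    intro x
    have hcs0 := abs_carreDuChamp_cutoff_le N T hR hη (w := w) (x.1, -x.2) (ω₂ := ω₂) (lam := lam) (β := β) (γ := γ)
    have hcs : |Γ χ w (x.1, -x.2)| ≤ 1 / (2 * η) * Γ χ χ (x.1, -x.2) + η / 2 * (χ₄ (x.1, -x.2) ^ 2 * Γ w w (x.1, -x.2)) := by
      rw [hχ, hχ₄]; exact hcs0
    rw [Real.norm_eq_abs, abs_mul, abs_mul, abs_of_nonneg (hπ0 x).le]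
    have h1 : |w (x.1, -x.2) * L χ (x.1, -x.2) + Γ χ w (x.1, -x.2)| ≤
        CG * |L χ (x.1, -x.2)| + (1 / (2 * η) * Γ χ χ (x.1, -x.2) + η / 2 * (χ₄ (x.1, -x.2) ^ 2 * Γ w w (x.1, -x.2))) := by
      calc _ ≤ |w (x.1, -x.2) * L χ (x.1, -x.2)| + |Γ χ w (x.1, -x.2)| := abs_add_le _ _
        _ ≤ _ := by
            rw [abs_mul]
            exact add_le_add (mul_le_mul_of_nonneg_right (hwb _) (abs_nonneg _)) hcs
    have h2 : 0 ≤ CG * |L χ (x.1, -x.2)| + (1 / (2 * η) * Γ χ χ (x.1, -x.2) + η / 2 * (χ₄ (x.1, -x.2) ^ 2 * Γ w w (x.1, -x.2))) :=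
      add_nonneg (by positivity) (add_nonneg (mul_nonneg (by positivity) (carreDuChamp_self_nonneg _ _ _ _))
        (mul_nonneg (by positivity) (mul_nonneg (sq_nonneg _) (carreDuChamp_self_nonneg _ _ _ _))))
    calc π x * |u x| * |w (x.1, -x.2) * L χ (x.1, -x.2) + Γ χ w (x.1, -x.2)| ≤
        π x * CF * (CG * |L χ (x.1, -x.2)| + (1 / (2 * η) * Γ χ χ (x.1, -x.2) + η / 2 * (χ₄ (x.1, -x.2) ^ 2 * Γ w w (x.1, -x.2)))) :=
          mul_le_mul (mul_le_mul_of_nonneg_left (hub x) (hπ0 x).le) h1 (abs_nonneg _) (mul_nonneg (hπ0 x).le hCF0)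
      _ = _ := by ring
  -- integrability of the bound
  have hJ1 : Integrable fun x => π x * |L χ (x.1, -x.2)| :=
    (hπc.mul (hLχc.comp hflip).abs).integrable_of_hasCompactSupport ((hasCompactSupport_comp_momentumFlip hLχs).norm.mul_left)
  have hJ2 : Integrable fun x => π x * Γ χ χ (x.1, -x.2) :=
    (hπc.mul (hΓχχc.comp hflip)).integrable_of_hasCompactSupport ((hasCompactSupport_comp_momentumFlip hΓχχs).mul_left)
  have hJ3 : Integrable fun x => π x * (χ₄ (x.1, -x.2) ^ 2 * Γ w w (x.1, -x.2)) := by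
    refine (hπc.mul (((hχ₄c.comp hflip).pow 2).mul (hΓwwc.comp hflip))).integrable_of_hasCompactSupport ?_
    have h4 : HasCompactSupport fun x : PhaseSpace N => χ₄ (x.1, -x.2) ^ 2 := by
      have e : (fun x : PhaseSpace N => χ₄ (x.1, -x.2) ^ 2) = fun x => χ₄ (x.1, -x.2) * χ₄ (x.1, -x.2) := funext fun x => sq _
      rw [e]; exact (hasCompactSupport_comp_momentumFlip hχ₄s).mul_right
    exact h4.mul_right.mul_left
  have hbound := norm_integral_le_of_norm_le (((hJ1.const_mul (CF * CG)).add
    (((hJ2.const_mul (1 / (2 * η))).add (hJ3.const_mul (η / 2))).const_mul CF))) (Eventually.of_forall hpt)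
  rw [Real.norm_eq_abs] at hbound
  refine hbound.trans (le_of_eq ?_)
  rw [integral_add' (hJ1.const_mul _) (((hJ2.const_mul _).add (hJ3.const_mul _)).const_mul CF),
    integral_const_mul, integral_const_mul, integral_add' (hJ2.const_mul _) (hJ3.const_mul _),
    integral_const_mul, integral_const_mul]
  -- flip the momenta in the three integrals
  have f1 := integral_comp_momentumReversal N fun x => π x * |L χ x|
  have f2 := integral_comp_momentumReversal N fun x => π x * Γ χ χ x
  have f3 := integral_comp_momentumReversal N fun x => π x * (χ₄ x ^ 2 * Γ w w x)
  simp only [hπΘ] at f1 f2 f3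
  rw [f1, f2, f3]

end Duality

end Summit.AtomisticToContinuum.FouriersLaw.Theorems

end
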